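import Summits.BirchSwinnertonDyer.Rank1Residual.O5.O5KummerLineTwisted
import Literature.NumberTheory.EllipticCurves.RootNumber
import HarnessLib

/-!
# O5 — GEN 7: the GLOBAL LINE `λ(ρ̄)` — Selmer transfer across the twisted tame classes at `3`,
# the exact `±1` jump III ↔ I₀*, its root-number shadow, and the O6-facing target T23d / T24c

Add-on to `O5KummerLine` (T17–T19, GEN 5) and `O5KummerLineTwisted` (T20–T22, GEN 6).
Census cell O5 = (t′), o5-r1 GEN 7 (planner-b2b-bsdres-o5-r1-g7-0, 2026-08-21).  Written proofs / derivations: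
`HOME/b2b-bsdres-o5-r1/gen7/T23-GLOBAL-LINE.md` (Thm 5, Thm 5′, C1–C4, T24; check units R8–R11 → harvest-2 E90).
HONEST FRAMING: every node below is an `@[conjecture] def … : Prop` — a THEOREM-CANDIDATE (derivation written, NOT
kernel-checked, NOT asserted) or a research CONJECTURE (T24c beyond the tame classes); census numbers are EVIDENCE
(P-K12, pre-registered `gen7/P-K12-PREREG.md`, frozen sha16 `f117466ee216ffd2` before the run, zero kit, all arms
0 exceptions); nothing booked; no mark of `RESIDUAL-MAP.md` moves; no main conjecture, no `p`-adic `L`-function and no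
BSD formula is an input of anything below.

## The mechanism (T23 Thm 5 / 5′)
For `ρ̄ : G_ℚ → GL₂(𝔽₃)` with `ρ̄|G_{ℚ₃} ≅ V ∈ {V₀, V₁}` (GEN 6 Thm 2: good-ss, III* ↦ `V₀`; III, I₀*-ss ↦ `V₁`) let
`S^rel ⊇ S_str` be the mod-3 Selmer groups of `ρ̄` with the UNRAMIFIED condition at every `ℓ ≠ 3`, nothing at `∞`, and
everything / nothing at `3`.  Greenberg–Wiles (DDT Thm 2.19; Washington, CSS 1997 §5 Thm 2) gives
`#S^rel/#S_str = 9 · (1/3) · 1 = 3` (local factor `#H¹(ℚ₃,V)/#H⁰ = 9`, archimedean factor `1/#H⁰(ℝ, ρ̄) = 1/3` since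
`det ρ̄(c) = −1`, all other factors `#H¹_ur/#H⁰ = 1`), so `λ(ρ̄) := res₃(S^rel)` is a LINE of the plane `H¹(ℚ₃, V)`;
Poitou–Tate reciprocity makes it ISOTROPIC, hence (GEN 6 Thm 4) `λ(ρ̄) ∈ {ℓ₅*, ℓ₇^iso}` (`V₁`) resp. `{ℓ₁*, ℓ₁₁^iso}`
(`V₀`) — the TYPE of `ρ̄`.  For a CLEAN member `W` (`W[3] ≅ ρ̄`, `H⁰(ℚ_ℓ, ρ̄) = 0` at its bad `ℓ ≠ 3`):
`dim Sel₃(W) = dim S_str(ρ̄) + [κ_W = λ(ρ̄)]`.  With the Kodaira-symbol ↦ line dictionary (T19/T20/T21: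
III*, good-ss ↦ `ℓ₁*`; III ↦ `ℓ₇^iso`; I₀*-ss ↦ `ℓ₅*`) this yields T23a (same class: equal), T23b (III vs I₀*: exactly
one factor `3`), and with Cassels–Tate + 3-parity the root-number laws T23c; T23d is Thm 5′ itself for arbitrary
(also WILD) reduction at `3`: KUM-EQUAL ⟺ `#Sel₃` equal.

READING OF THE DECLARATIONS.  Predicates with bodies (census-decidable): `IsCongruentModThree` (the `a_ℓ`-clause of
`IsCompanionAtThree` without the semistability clause), `IsCleanPairAwayFromThree`.  `@[conjecture]` nodes:
T23a `SelmerTransferTameClassThree`, T23b `SelmerJumpTwistedClassesThree`, T23c `RootNumberTwistedClassesThree` and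
`RootNumberTameClassThree`, T23d `SelmerReadsKummerLineThree`, T24c `KummerLineByRootNumberCongruentThree`.
Theorems (PROVED): `rootNumber_neg_of_jump` (arithmetic of powers of `3`) and the edge `rootNumberTwisted_of_jump`
(T23b + parity inputs as hypotheses ⟹ T23c).

## TYPER PLACEMENT NOTE (cc-typer-5 GEN 8, typer of record O5 §3.5, 2026-08-21)

HONEST FRAMING (cell `b2b-bsdres`, run/shared/lean/b2b/bsd-rank1-residual/, verbatim in every
file): the goal of the cell is to DELETE the COMBINATION-SHAPED residual classes of the
Birch–Swinnerton-Dyer formula for ALL analytic-rank `≤ 1` elliptic curves over `ℚ` — assembled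
STRICTLY from published theorems — so that the rank-`≤ 1` remainder becomes exactly the
CONSTRUCTION-SHAPED classes, which are TYPED (missing-input `Prop`s), NOT attempted. This is not
"finishing BSD". Lane CLASS-CLOSURE (`CLASS-CLOSURE-PLAN.md` §3.5 O5; TRANSPORT deliverable (c): each
node below is a COMPARISON STATEMENT along a mod-3 CONGRUENCE — Selmer order / root number transported
across a clean congruent pair, with the printed antecedents Greenberg–Wiles (DDT 2.19), Cassels–Tate
parity [MazurRubin2007 2.1], 3-parity [DokchitserDokchitserAnnals2010 1.4], Kobayashi 2002 Thm 1.1):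
research routes; no claim beyond the stated classes; census output is EVIDENCE / conjecture items, never a
Literature fact; nothing is booked; no mark of `RESIDUAL-MAP.md` moves. NO Literature fact is minted here.

PROVENANCE. The module text above this note and every declaration below are o5-r1 GEN 7's draft
`HOME/b2b-bsdres-o5-r1/gen7/O5GlobalLine.lean` (sha16 `f07479cfe3c464a3`, 220 lines; typing ask A-O5-19,
`HOME/INBOX.md` o5-r1 GEN 7 line; derivation `gen7/T23-GLOBAL-LINE.md` sha16 `2750af322491a921`;
pre-registration `gen7/P-K12-PREREG.md` sha16 `d6b579894d0d5710`, §0–§3 frozen as `f117466ee216ffd2` before the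
run; `cells/o5o6/TARGETS.md` §O5 '#### o5-r1 GEN 7'), with the `@[conjecture]` statements BYTE-IDENTICAL and
three typer changes: the `import HarnessLib` line, this note, and ONE audit-class adjustment — the PROVED edge
`rootNumberTwisted_of_jump` no longer takes the hypothesis `hsgn` ("root numbers are signs"): it is the tree
theorem `WeierstrassCurve.rootNumber_eq_one_or` (`Literature/…/RootNumber.lean`), now used directly; the
remaining parity binders `hpow` (= the tree's `WeierstrassCurve.exists_natCard_selmerGroup_eq_pow`,
`BSDRankZeroDensity.lean`, not imported here to keep the import cone small), `hpar` (Cassels–Tate + 3-parity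
on `LocIrr` rows) and `hgss` (I₀*-ss ⇒ `LocIrr`) stay explicit, as drafted.  CHECK STATUS: the derivation
(Thm 5 / 5′, C1–C4, T24) is UNDER INDEPENDENT CHECK — harvest-2 E91 (R8 Greenberg–Wiles bookkeeping, R9 local
root numbers of clean congruent pairs, R10 T24 plausibility, R11 type constraint), requested in the same INBOX
line, NOT yet delivered at landing; every node keeps its `@[conjecture]` tag until a KERNEL proof (cc-lead
⟦gen22⟧ (8)(b), ⟦gen23⟧ (8)(c): tag = kernel status, docstring = paper status) and the docstrings'
THEOREM-CANDIDATE wording is o5-r1's, pending E91.  DEDUP (`lean search`): no prior `IsCongruentModThree` /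
`IsCleanPairAwayFromThree` / `Selmer…Three` / `RootNumber…Three` / `…KummerLine…Three` of these names; the
nearest tree predicates are `O5.IsCompanionAtThree` (= `IsCongruentModThree ∧ 9 ∤ N_G`; here both members may be
additive at `3`, so a new name is right) and T17's inline clean clause (= `IsCleanPairAwayFromThree` verbatim);
`W.rootNumber` is the tree's ANALYTIC sign (`RootNumber.lean`; `localRootNumber` is junk at additive `3`, hence
no local form — o5-r1's decision, concurred).  Kobayashi 2002 Thm 1.1 (`w₃` on the additive Kodaira types) is
CITED in docstrings only, not vendored as a Literature fact (no `localRootNumber`-free phrasing available; a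
harvest decision if ever load-bearing).  Every `[cite: …]` key exists in `references.bib` (MazurRubin2007,
DokchitserDokchitserAnnals2010, Kobayashi2002 — added by o5-r1 GEN 7 —, PoonenRains2012).
0 Literature facts; net debt 0; nothing booked; no mark of `RESIDUAL-MAP.md` moves.

## CHECK NOTE (cc-typer-5 GEN 9, 2026-08-21 — DOC-ONLY: no declaration or statement changed, tags unchanged)

The independent check requested above HAS BEEN DELIVERED: harvest-2 GEN 43, renumbered **E92** (GEN 42 used "E91"
for an O6 item), `HOME/b2b-bsdres-harvest-2/gen43/E92-T23-check.md` sha16 `dcbfb816c4c65b2e`, `HOME/INBOX.md`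
2026-08-21T18:40Z. Verdicts, as they bear on the nodes of THIS file (paper status; kernel status = the tags):
* **R8 ✓ (Thm 5 / 5′ — T23a, T23b, T23d):** (a) exact annihilators `H¹_ur(X)^⊥ = H¹_ur(X*)` for every finite `X`
  with `ℓ ∤ #X` [Washington in CSS 1997, Thm 1(c), p. 162]; (b) the Greenberg–Wiles product is DDT's with the
  ORDINARY `H⁰` at `∞`, so the archimedean factor `1/3` is right; (c) `Σ inv_v = 0` is sign-free Poitou–Tate
  exactness. Thm 5 re-derived independently and identified IN PRINT: it is Mazur–Rubin, Annals 166 (2007)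
  Prop. 1.3 (i) [cite: MazurRubin2007, Prop. 1.3 (i)], Thm 5′'s parity form = [cite: MazurRubin2007, Thm. 1.4], and
  the §3.2 input = [cite: MazurRubin2007, Prop. 2.1] verbatim. So T23d's "why it might fail: Thm 5 (R8)" is
  DISCHARGED ON PAPER; what remains for T23a/b/d is the line dictionary at `3` (T19–T22, checked E88/E90) — a KERNEL
  proof is the open item, nothing else.
* **R9 ✓ (away-from-3 local signs of CLEAN congruent pairs — T23c, T23c′, and the "equivalently, by R9" clause of
  T24c):** complete case table at `ℓ ≥ 5` by inertia image `Φ̄ ∈ {1, C₃, {±1}, {±1}×C₃, C₄}` from Rohrlich's closed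
  forms (tree `RootNumber.lean`), cleanliness entering in exactly two mixed cases; wording precisions R9-i (case
  (b): `w = (−2|ℓ)` iff `|Φ̄| = 4`, else `(−1|ℓ)`) and R9-ii (pot-mult additive sits in case (b)); `ℓ = 2`
  non-additive likewise; `ℓ = 2` additive and the UNCLEAN general case are IN PRINT: Nekovář, Compositio 151 (2015)
  1626–1646, `(−1)^{δ_v(T,T′)} = ε_v(V)/ε_v(V′)` for residually symplectically isomorphic `V, V′` at `v ∤ p`
  (clean ⟹ `H¹(ℚ_v, ρ̄) = 0` ⟹ `δ_v = 0` ⟹ `w_v(W) = w_v(X)` for all types incl. `ℓ = 2`; primary text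
  acq-09724). The unclean correction by the Tamagawa bits is o5-r1 GEN 8's T25 family (`O5/O5UncleanParity.lean`).
* **R10 — T24 / T24c are consequences of a THEOREM OF AN AUGUST-2025 PREPRINT:** Burungale–Kobayashi–Nakamura–Ota,
  *A local sign decomposition for symplectic self-dual Galois representations of rank two*, arXiv:2508.17776,
  Thm 1.3: for `p` odd and any GENERIC (`H⁰(ℚ_p, T̄) = 0`) symplectic self-dual rank-2 `(𝓡, 𝓣)`, `H¹(ℚ_p, 𝓣) =
  H¹₊ ⊕ H¹₋`, two Lagrangians, functorial, with (4) `H¹_{−ε̂_p(T)} = H¹_f` for de Rham `T`; for `T = T_pE` and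
  reduction to `𝔽_p`: **`κ_E = H¹_{−w_p(E)}(ℚ_p, E[p])` for every `E/ℚ_p` with `E(ℚ_p)[p] = 0`**, hence for
  `φ : E[3] ≅ E′[3]` over `ℚ₃`: `φ_*κ_E = κ_{E′} ⟺ w₃(E) = w₃(E′)` — o5-r1's T24 in full (tame AND wild), and their
  Thm 1.10 is the Mazur–Rubin form `ε̂_p(V₁)/ε̂_p(V₂) = (−1)^{δ_p(T₁,T₂)}` = T24c / T23d "defect read by the local
  root number" [cite: BurungaleKobayashiNakamuraOta2025, Thm. 1.3 (4) and Thm. 1.10 (arXiv 2508.17776 v1; PREPRINT)].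
  STATUS of T24 / T24c: 'o5-r1 conjecture' ↦ **ANNOUNCED / PREPRINT** (no DOI found 2026-08-21) — citable in
  docstrings, NEVER a kernel input; the lane's rule 'announced = OPEN' keeps the `@[conjecture]` tags exactly as
  they are. What BKNO does NOT have and o5-r1 does (v2 Thms 1–4 + Kobayashi (i)(ii)): an INDEPENDENT elementary proof
  on the four tame supersingular classes at `3` with the explicit dictionary `H¹₋(V₀) = ℓ₁*`, `H¹₊(V₀) = ℓ₁₁^iso`,
  `H¹₋(V₁) = ℓ₇^iso`, `H¹₊(V₁) = ℓ₅*` — "the part worth the kernel" (harvest-2). Wording precision adopted for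
  T24: the pair `(κ_E, w₃(E))` takes AT MOST two values on a local class (on `V₀` every tame member has `(ℓ₁*, +1)`;
  whether a WILD curve realises `H¹₊(V₀)` is not settled by Thm 2). Prior art to be listed with T23/T24 (BC8):
  Mazur–Rubin 2007 §1; Nekovář, ANT 7 (2013) 1101; Nekovář, Compositio 151 (2015); Nekovář, PLMS 116 (2018) 378
  (`v ∣ p`, tame ABELIAN potentially Barsotti–Tate — per BKNO's paraphrase I₀* (`e = 2`) is inside, the `e = 4`
  classes III / III* are NOT; acq-09728 to confirm); BKNO 2025. Claimed delta after E92: `λ(ρ̄)` + its parity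
  formula + the conductor/Kodaira dictionary + the census — NOT "the `±1` law read by a local line" as such.
* **R11 — parity FIXES the type:** with `P(ρ̄) := ∏_{ℓ ∤ 3∞} w_ℓ(clean member)` (well-defined by C4′),
  `λ(ρ̄) = H¹_{−(−1)^{s(ρ̄)} P(ρ̄)}(ℚ₃, ρ̄)` — `λ = ℓ₇^iso` (type III) ⟺ `P = (−1)^s`, `λ = ℓ₅*` ⟺ `P = −(−1)^s`;
  o5-r1's Q1 is the joint law of `(s mod 2, P)`, not a new invariant; row-by-row test: type III ⟺
  `(−1)^{rank X + s} = +1`, `s = min(dim Sel₃ W, dim Sel₃ X)`.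
* **(5) the LOCAL sign at `3` is typable after all:** Kobayashi 2002 Thm 1.1 (i)(ii) (I₀/I₀*: `w = (−1|k)^{v(Δ)/2}`;
  III/III*: `w = (−2|k)`; at `ℚ₃`: I₀* `−1`, III `+1`, III* `+1`) are ROWS of the tree's `Rizzo.tableII`
  (`Literature/…/RootNumberTableThree.lean`, validated on 923 952 curves), and the tree HAS a non-junk `w₃`:
  `W.rootNumberThree = W.fullTableLocalRootNumberAt v₃` with the named fact
  `rootNumber_eq_neg_finprod_fullTableLocalRootNumberAt`. So the sentence in T24c's docstring "the purely local
  strengthening T24 … is NOT typed (the tree's `localRootNumber` is a junk value at additive `3`)" is SUPERSEDED as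
  to typability: T24 in the congruent setting — torsors agree ⟺ `W.rootNumberThree = X.rootNumberThree`, NO clean
  hypothesis — is typable over that vocabulary, in a sibling file on o5-r1's word (typer's offer A-O5-21; the
  symbol-wise corollary 'III ↦ +1, I₀* ↦ −1, III* ↦ +1' is a `decide` over the 24 rows plus the identification
  `tableKodairaSymbolThree = kodairaSymbolAt`, not in the tree). Kobayashi's theorem is NOT vendored as a Literature
  fact (harvest-2: no kernel consumer, D-0026).
EVIDENCE recount (cc-eng-2 GEN 8 audit of P-K12's links, INBOX 18:29Z; o5-r1 GEN 8 concurs): the 208 struck links are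
cc-eng-2's GEN 5 `deep1000` strike list count for count, plus 8 P-K12-ACCEPTED pairs failing at `ℓ = 107`, all
`clean = False` — the CLEAN arms B / B′ / C quoted in the docstrings below are unaffected. Nothing here moves a tag,
a count of record or a mark; 0 Literature facts.
-/

open scoped Classical

open Polynomial WeierstrassCurve Literature.NumberTheory.EllipticCurves
  Summit.BirchSwinnertonDyer.Rank1Residual.Additive

namespace Summit.BirchSwinnertonDyer.Rank1Residual.O5

/-! ## §1 Vocabulary -/

/-- **Mod-3 congruence of traces** away from `3·N_W·N_X`: `a_ℓ(W) ≡ a_ℓ(X) (mod 3)` for every prime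
`ℓ ∤ 3 N_W N_X` (so `ρ̄_W^{ss} ≅ ρ̄_X^{ss}` by Brauer–Nesbitt–Chebotarev, and `ρ̄_W ≅ ρ̄_X` when `ρ̄_W` is irreducible).
= the second clause of `IsCompanionAtThree` (which additionally demands `9 ∤ N_X`; here BOTH curves may be additive at
`3`).  Census object: cc-eng-2's CONG-v1 link table, screened at `ℓ ≤ 97` — a typed instance needs ALL `ℓ` (Sturm
bound); P-K12 found its false links at `ℓ ∈ {101, 127, 131}`. [folklore] -/
def IsCongruentModThree (W X : WeierstrassCurve ℚ) [W.IsElliptic] [W.IsGloballyMinimal]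
    [X.IsElliptic] [X.IsGloballyMinimal] : Prop :=
  ∀ ℓ : ℕ, ℓ.Prime → ¬ (ℓ ∣ 3 * W.conductorNorm ℤ * X.conductorNorm ℤ) →
    ((W.LFunction ℓ : ℤ) : ZMod 3) = ((X.LFunction ℓ : ℤ) : ZMod 3)

/-- **Clean pair away from `3`**: `W(ℚ_ℓ)[3] = 0` (`H⁰(ℚ_ℓ, ρ̄) = 0`, equivalently `H¹(ℚ_ℓ, ρ̄) = 0`) at every prime
`ℓ ≠ 3` dividing `N_W N_X` — the hypothesis under which the two mod-3 Selmer groups inside `H¹(ℚ, ρ̄)` differ at most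
in the local condition at `3` (T17's clause, verbatim). [folklore] -/
def IsCleanPairAwayFromThree (W X : WeierstrassCurve ℚ) [W.IsElliptic] [W.IsGloballyMinimal]
    [X.IsElliptic] [X.IsGloballyMinimal] : Prop :=
  ∀ (ℓ : ℕ) (hℓ : ℓ.Prime), ℓ ≠ 3 → (ℓ : ℤ) ∣ W.conductorNorm ℤ * X.conductorNorm ℤ →
    @NoLocalThreeTorsionAt W ℓ ⟨hℓ⟩

/-! ## §2 T23a / T23b — Selmer transfer inside a tame class and the exact jump across the twisted classes -/

/-- **T23a `SelmerTransferTameClassThree` (THEOREM-CANDIDATE, o5-r1 GEN 7; proof: T23-GLOBAL-LINE.md Thm 5′ + C1,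
or directly as T17: equal local conditions at every place).**  Two tame potentially supersingular additive curves at
`3` (`ClassO5`: Kodaira III / I₀*-ss / III*) with THE SAME `v₃(Δ_min) ∈ {3, 6, 9}` (same symbol, hence the same local
module `V₀`/`V₁` AND the same universal Kummer line `ℓ₇^iso` / `ℓ₅*` / `ℓ₁*` — T20 / T21 / T19), `W[3]` irreducible
locally (`LocIrr`) and globally, congruent mod `3` and CLEAN, have 3-Selmer groups of the same order.  (The mixed
same-module case III* ~ good-ss is T17 `CleanSelmerTransferThree`.)  Why it might fail: only through T19–T21.
[evidence: census cell O5, o5-r1 GEN 7, P-K12 arm B: same-class clean pairs III~III 167, I₀*~I₀* 557, III*~III* 297 (+ III*~gss 1 271): equal rank parity 2 292 / 2 292; arm C (BSD data, r + v₃(Ш_an)) equal 2 291 / 2 291; 0 exceptions] -/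
@[conjecture] def SelmerTransferTameClassThree : Prop :=
  ∀ (W X : WeierstrassCurve ℚ) [W.IsElliptic] [W.IsGloballyMinimal] [X.IsElliptic] [X.IsGloballyMinimal],
    ClassO5 W 3 → ClassO5 X 3 → LocIrr W 3 → W.HasIrreducibleModPGaloisRep 3 →
    padicValRat 3 W.Δ = padicValRat 3 X.Δ →
    IsCongruentModThree W X → IsCleanPairAwayFromThree W X →
      Nat.card (W.selmerGroup 3) = Nat.card (X.selmerGroup 3)

/-- **T23b `SelmerJumpTwistedClassesThree` (THEOREM-CANDIDATE, o5-r1 GEN 7; proof: T23-GLOBAL-LINE.md Thm 5/5′ +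
C2).**  For a CLEAN mod-3 congruent pair (`W` of Kodaira type III at `3` with `W[3]|G_{ℚ₃}` irreducible, `X` of type
I₀* potentially SUPERSINGULAR — the two classes carrying `V₁ = V₀ ⊗ ω` with the two DIFFERENT isotropic lines
`ℓ₇^iso ≠ ℓ₅*`, T22) the 3-Selmer orders differ by EXACTLY one factor `3`: `{κ_W, κ_X}` is the set of both
isotropic lines of `H¹(ℚ₃, V₁)`, the global line `λ(ρ̄)` is one of them, and `dim Sel₃ = dim S_str(ρ̄) + [κ = λ(ρ̄)]`.
Which side is larger is the TYPE of `ρ̄` (`λ = ℓ₇^iso`: `W`; `λ = ℓ₅*`: `X`), an invariant of the web not of the pair.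
Why it might fail: through T20/T21 (line assignment) or Thm 5 (R8).
[evidence: census cell O5, o5-r1 GEN 7, P-K12: clean III~I₀* pairs 974 — arm B opposite rank parity 974 / 974 (unclean contrast 10 078 : 9 373); arm C |Δ(r + v₃ Ш_an)| = 1 on 974 / 974, types 494 (III side larger) : 480; arm D: the only rank ≥ 2 cross partners of rank-0 rows with 9 ∥ Ш_an are the three RANK-3 curves 287775a1, 456201a1, 493866c1, as 'dim 2 ± 1 odd' forces] -/
@[conjecture] def SelmerJumpTwistedClassesThree : Prop :=
  ∀ (W X : WeierstrassCurve ℚ) [W.IsElliptic] [W.IsGloballyMinimal] [X.IsElliptic] [X.IsGloballyMinimal],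
    ClassO5 W 3 → SubTprime W 3 → LocIrr W 3 → padicValRat 3 W.Δ = 3 → W.HasIrreducibleModPGaloisRep 3 →
    ClassO5 X 3 → SubGss X 3 →
    IsCongruentModThree W X → IsCleanPairAwayFromThree W X →
      Nat.card (W.selmerGroup 3) = 3 * Nat.card (X.selmerGroup 3) ∨
        Nat.card (X.selmerGroup 3) = 3 * Nat.card (W.selmerGroup 3)

/-! ## §3 T23c — the root-number shadow (parity across / within the twisted classes) -/

/-- **T23c `RootNumberTwistedClassesThree` (THEOREM-CANDIDATE given T23b; o5-r1 GEN 7, T23-GLOBAL-LINE.md C3).**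
A clean mod-3 congruence between a type-III curve (locally irreducible `W[3]`) and an I₀*-supersingular curve forces
OPPOSITE global root numbers — "odd total rank".  Derivation: T23b + Cassels–Tate (`dim Sel₃ ≡ corank Sel_{3^∞}
(mod 2)` when `E(ℚ)[3] = 0` [cite: MazurRubin2007, Prop. 2.1]) + 3-parity (`Literature.NumberTheory.EllipticCurves.p_parity`,
[cite: DokchitserDokchitserAnnals2010, Thm. 1.4]).  SECOND derivation, local: `w₃(III) = (−2|𝔽₃) = +1`,
`w₃(I₀*) = (−1|𝔽₃)^{v(Δ)/2} = −1` [cite: Kobayashi2002, Thm. 1.1 (i)(ii)] and the away-from-3 local root numbers of a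
clean congruent pair agree prime by prime (T23 §3.3, check unit R9) — Kobayashi's sign flip III ↔ I₀* is the
root-number shadow of `ℓ₇^iso ≠ ℓ₅*`.  (`W.rootNumber` is the analytic sign; the tree's `localRootNumber` takes a junk
value at additive `2, 3`, so no local form is typed here.)  Why it might fail: only with T23b or R9.
[evidence: census cell O5, o5-r1 GEN 7, P-K12 arm A: empirical w₃ = −(−1)^r ∏_{ℓ≠3} w_ℓ is +1 on 44 301 / 44 301 III and 44 301 / 44 301 III* rows, −1 on 24 437 / 24 437 I₀*-ss and 44 345 / 44 345 I₀*-ordinary rows (Rohrlich at ℓ ≥ 5, rows additive at 2 excluded); arm B 974 / 974; arm B′ away-from-3 products equal 741 / 741] -/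
@[conjecture] def RootNumberTwistedClassesThree : Prop :=
  ∀ (W X : WeierstrassCurve ℚ) [W.IsElliptic] [W.IsGloballyMinimal] [X.IsElliptic] [X.IsGloballyMinimal],
    ClassO5 W 3 → SubTprime W 3 → LocIrr W 3 → padicValRat 3 W.Δ = 3 → W.HasIrreducibleModPGaloisRep 3 →
    ClassO5 X 3 → SubGss X 3 →
    IsCongruentModThree W X → IsCleanPairAwayFromThree W X →
      W.rootNumber = - X.rootNumber

/-- **T23c′ `RootNumberTameClassThree` (THEOREM-CANDIDATE given T23a; o5-r1 GEN 7).**  Same-symbol clean congruent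
pairs (hypotheses of `SelmerTransferTameClassThree`) have EQUAL global root numbers.  [evidence: census cell O5, o5-r1 GEN 7, P-K12 arm B same-class 2 292 / 2 292] -/
@[conjecture] def RootNumberTameClassThree : Prop :=
  ∀ (W X : WeierstrassCurve ℚ) [W.IsElliptic] [W.IsGloballyMinimal] [X.IsElliptic] [X.IsGloballyMinimal],
    ClassO5 W 3 → ClassO5 X 3 → LocIrr W 3 → W.HasIrreducibleModPGaloisRep 3 →
    padicValRat 3 W.Δ = padicValRat 3 X.Δ →
    IsCongruentModThree W X → IsCleanPairAwayFromThree W X →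
      W.rootNumber = X.rootNumber

/-- Bookkeeping (PROVED): T23c follows from T23b and the two parity facts, abstracted as hypotheses on the pair:
`hpar` = "(−1)^{dim Sel₃} = w" for each curve (Cassels–Tate + 3-parity, with `Nat.card (Sel₃) = 3 ^ dim`), stated
multiplicatively as `w = 1 ↔ Nat.card Sel₃ is a power of 9`.  Pure logic + arithmetic of powers of `3`; recorded so
that the assembly T23b + parity ⟹ T23c is kernel-checked once the parity facts are instantiated from the tree. [folklore] -/
theorem rootNumber_neg_of_jump {a b : ℕ} {w v : ℤ} (hw : w = 1 ∨ w = -1) (hv : v = 1 ∨ v = -1)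
    (ha : ∃ n : ℕ, a = 3 ^ n) (hb : ∃ m : ℕ, b = 3 ^ m)
    (hpa : w = 1 ↔ ∃ k : ℕ, a = 9 ^ k) (hpb : v = 1 ↔ ∃ k : ℕ, b = 9 ^ k)
    (hjump : a = 3 * b ∨ b = 3 * a) : w = -v := by
  obtain ⟨n, rfl⟩ := ha
  obtain ⟨m, rfl⟩ := hb
  have key : ∀ t : ℕ, (∃ k : ℕ, (3 : ℕ) ^ t = 9 ^ k) ↔ Even t := by
    intro t
    constructor
    · rintro ⟨k, hk⟩
      have h9 : (9 : ℕ) ^ k = 3 ^ (2 * k) := by rw [pow_mul]; norm_num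
      have ht : t = 2 * k := Nat.pow_right_injective (by norm_num : 2 ≤ 3) (hk.trans h9)
      exact ⟨k, by omega⟩
    · rintro ⟨k, hk⟩
      exact ⟨k, by rw [hk, ← two_mul, pow_mul]; norm_num⟩
  have h3 : ∀ s t : ℕ, (3 : ℕ) ^ s = 3 * 3 ^ t → s = t + 1 := by
    intro s t h
    apply Nat.pow_right_injective (by norm_num : 2 ≤ 3)
    show 3 ^ s = 3 ^ (t + 1)
    rw [pow_succ, mul_comm]; exact h
  have hn : Even n ↔ ¬ Even m := by
    rcases hjump with h | h
    · rw [h3 n m h, Nat.even_add_one]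
    · rw [h3 m n h, Nat.even_add_one]; tauto
  simp only [key] at hpa hpb
  rcases hw with rfl | rfl <;> rcases hv with rfl | rfl
  · exact absurd (hpb.mp rfl) (hn.mp (hpa.mp rfl))
  · norm_num
  · norm_num
  · exfalso
    have h1 : ¬ Even n := fun h => by have := hpa.mpr h; norm_num at this
    have h2 : ¬ Even m := fun h => by have := hpb.mpr h; norm_num at this
    exact h1 (hn.mpr h2)

/-- **PROVED edge T23b ⟹ T23c** modulo the parity inputs, taken as hypotheses in the shape in which they will be
instantiated from the tree: `hpow` (`#Sel₃` is a power of `3` — an `𝔽₃`-space; tree: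
`WeierstrassCurve.exists_natCard_selmerGroup_eq_pow`, `Literature/…/BSDRankZeroDensity.lean`), `hpar` (`w(E) = 1 ↔
dim Sel₃(E)` even, for curves with `E[3]|G_{ℚ₃}` irreducible, hence `E(ℚ)[3] = 0`: Cassels–Tate
[cite: MazurRubin2007, Prop. 2.1] + 3-parity [cite: DokchitserDokchitserAnnals2010, Thm. 1.4]), `hgss` (an
I₀*-supersingular curve is locally irreducible at `3`: twist of a good supersingular curve, GEN 6 Thm 2 with
`m = 2`).  "Root numbers are signs" is the tree theorem `WeierstrassCurve.rootNumber_eq_one_or` (used directly —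
typer adjustment of o5-r1's draft, which carried it as a hypothesis `hsgn`).  Pure bookkeeping over
`rootNumber_neg_of_jump`. [folklore] -/
theorem rootNumberTwisted_of_jump
    (hpow : ∀ (E : WeierstrassCurve ℚ) [E.IsElliptic] [E.IsGloballyMinimal],
        ∃ n : ℕ, Nat.card (E.selmerGroup 3) = 3 ^ n)
    (hpar : ∀ (E : WeierstrassCurve ℚ) [E.IsElliptic] [E.IsGloballyMinimal], LocIrr E 3 →
        (E.rootNumber = 1 ↔ ∃ k : ℕ, Nat.card (E.selmerGroup 3) = 9 ^ k))
    (hgss : ∀ (E : WeierstrassCurve ℚ) [E.IsElliptic] [E.IsGloballyMinimal], ClassO5 E 3 → SubGss E 3 → LocIrr E 3)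
    (hjump : SelmerJumpTwistedClassesThree) : RootNumberTwistedClassesThree := by
  intro W X _ _ _ _ h5 ht hli hv hirr h5' hg hc hcl
  exact rootNumber_neg_of_jump (rootNumber_eq_one_or W) (rootNumber_eq_one_or X) (hpow W) (hpow X)
    (hpar W hli) (hpar X (hgss X h5' hg)) (hjump W X h5 ht hli hv hirr h5' hg hc hcl)

/-! ## §4 T23d / T24c — the O6-facing target: the Selmer group and the root number read the Kummer line -/

/-- **T23d `SelmerReadsKummerLineThree` (THEOREM-CANDIDATE = T23 Thm 5′, o5-r1 GEN 7; ANY reduction at `3`).**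
For a clean mod-3 congruent pair `W, X` with `W[3]` irreducible globally and LOCALLY AT `3` (so `X[3] ≅ W[3]`, the
plane `H¹(ℚ₃, W[3])` is hyperbolic, both Kummer lines are isotropic [cite: PoonenRains2012, Prop. 4.11], and the
global line `λ(ρ̄)` is one of the two isotropic lines): the Kummer torsors at `3` agree (KUM-EQUAL, the finite
3-adic test `KummerTorsorsAgreeAtThree`) IFF the 3-Selmer groups have the same order; otherwise the orders differ
by exactly one factor `3`.  No hypothesis on the reduction of `W`, `X` at `3` (tame III / I₀* / III*, WILD II / IV /
IV* / II*, or good supersingular) beyond local irreducibility — this is the transfer law offered to the wild cell O6.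
Why it might fail: Thm 5 (R8: Greenberg–Wiles count, archimedean factor, reciprocity) — not through any local
classification.  CHECK (cc-typer-5 GEN 9 note, 2026-08-21): R8 ✓ in all three parts — harvest-2 E92
(`gen43/E92-T23-check.md` dcbfb816c4c65b2e); Thm 5 is [cite: MazurRubin2007, Prop. 1.3 (i)] and Thm 5′'s parity form
[cite: MazurRubin2007, Thm. 1.4]; the local sign law behind it is the PREPRINT theorem
[cite: BurungaleKobayashiNakamuraOta2025, Thm. 1.10 (arXiv 2508.17776; PREPRINT)] (module CHECK NOTE); tag unchanged.
[evidence: census cell O5, o5-r1 GEN 7: on the tame classes = T23a/T23b evidence (P-K12 arms B, C: 3 266 clean pairs, 0 exceptions); wild pairs: P-K13 proposed (T23-GLOBAL-LINE.md §5), not run] -/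
@[conjecture] def SelmerReadsKummerLineThree : Prop :=
  ∀ (W X : WeierstrassCurve ℚ) [W.IsElliptic] [W.IsGloballyMinimal] [X.IsElliptic] [X.IsGloballyMinimal],
    LocIrr W 3 → W.HasIrreducibleModPGaloisRep 3 →
    IsCongruentModThree W X → IsCleanPairAwayFromThree W X →
      ∀ x y x' y' : ℚ_[3], IsKummerBasePointThree W x y → IsKummerBasePointThree X x' y' →
        (KummerTorsorsAgreeAtThree W X x x' ↔ Nat.card (W.selmerGroup 3) = Nat.card (X.selmerGroup 3)) ∧
        (¬ KummerTorsorsAgreeAtThree W X x x' ↔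
          (Nat.card (W.selmerGroup 3) = 3 * Nat.card (X.selmerGroup 3) ∨
            Nat.card (X.selmerGroup 3) = 3 * Nat.card (W.selmerGroup 3)))

/-- **T24c `KummerLineByRootNumberCongruentThree` (CONJECTURE-class; o5-r1 GEN 7, T23-GLOBAL-LINE.md T24 / §3.5 —
THEOREM-CANDIDATE given T23d + Cassels–Tate + 3-parity + the away-from-3 root-number agreement R9).**  "The root
number reads the Kummer line": for a clean mod-3 congruent pair, locally irreducible at `3`, ANY reduction at `3`, the
Kummer torsors at `3` agree IFF the global root numbers agree (equivalently, by R9, iff the LOCAL root numbers at `3`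
agree — Kobayashi's formula [cite: Kobayashi2002, Thm. 1.1] on the wild types II, IV, IV*, II*).  The purely local
strengthening T24 (same statement for two curves over `ℚ₃` with isomorphic irreducible `E[3]`, no congruence) is the
research conjecture proper and is NOT typed (the tree's `localRootNumber` is a junk value at additive `3`).  Tame
instances: III (w₃ = +1, `ℓ₇^iso`) vs I₀*-ss (w₃ = −1, `ℓ₅*`): torsors differ, signs differ (T22 + Kobayashi);
III*, good-ss (both +1, both `ℓ₁*`).  Why it might fail: a wild class on which `(κ_E, w₃(E))` takes three values;
first computation P-K13 (kumP × ellrootno on the 31 191 tame~wild links).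
STATUS (cc-typer-5 GEN 9 note, 2026-08-21, after harvest-2 E92 R9 ✓ / R10): the local sign law "`κ_E = H¹_{−w₃(E)}`,
so torsors agree iff `w₃` agree" is a theorem of the PREPRINT [cite: BurungaleKobayashiNakamuraOta2025, Thm. 1.3 (4) and Thm. 1.10 (arXiv 2508.17776 v1; PREPRINT)]
— 'o5-r1 conjecture' ↦ ANNOUNCED / PREPRINT, tag unchanged (announced = OPEN); `(κ_E, w₃(E))` takes AT MOST two
values on a local class; and the sentence above on typability is SUPERSEDED: the LOCAL form is typable over the tree's
non-junk `W.rootNumberThree` (= `fullTableLocalRootNumberAt v₃`, `RootNumberTableThree.lean`) — module CHECK NOTE (5),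
typer's offer A-O5-21.
[evidence: census cell O5, o5-r1 GEN 7, P-K12: tame~tame clean pairs 3 266 / 3 266 consistent (arms B, B′); tame~WILD clean pairs split ≈ 1:1 in rank parity inside every (class, v₃N, v₃Δ) cell (e.g. I₀*~wild(3,3) 375 : 322) — so the wild Kummer line is NOT a function of (v₃ N, v₃ Δ); P-K13 not run] -/
@[conjecture] def KummerLineByRootNumberCongruentThree : Prop :=
  ∀ (W X : WeierstrassCurve ℚ) [W.IsElliptic] [W.IsGloballyMinimal] [X.IsElliptic] [X.IsGloballyMinimal],
    LocIrr W 3 → W.HasIrreducibleModPGaloisRep 3 →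
    IsCongruentModThree W X → IsCleanPairAwayFromThree W X →
      ∀ x y x' y' : ℚ_[3], IsKummerBasePointThree W x y → IsKummerBasePointThree X x' y' →
        (KummerTorsorsAgreeAtThree W X x x' ↔ W.rootNumber = X.rootNumber)

end Summit.BirchSwinnertonDyer.Rank1Residual.O5
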